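import Mathlib
import HarnessLib
import Summits.HubbardSuperconductivity.HubbardSuperconductivity.Theorems.KLProgrammeKLRegimeEnginePairTransferOutClassFrameShiftSizesLast
import Summits.HubbardSuperconductivity.HubbardSuperconductivity.Theorems.KLProgrammeKLRegimeFrameShellCount
import Summits.HubbardSuperconductivity.HubbardSuperconductivity.Theorems.KLProgrammeKLRegimeEngineTwoLegReadDriverHist

/-!
# Route `KLProgramme` — ENGINE item stmt-HubbardSuperconductivity-20437 `KLRegimeEngineV17F2`, stub (c) value lane: the band-shell GEOMETRY ROW of
# `hshift_of_sizes` DISCHARGED (k3c4-p1's frame shell count, pen g24 (R290) «a 20-line corollary of p465249»; cell gate-hubbard-kl, seat p2 g24)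

`hshift_of_sizes(_klRegime)` asks the band-shell count `#{k⃗ : |e_{Kₙ₋₁}(k⃗)| < 5Λₙ/4} ≤ C_b·L²·Λₙ`.  For an ADMISSIBLE frame this is k3c4-p1's
`card_frameLevel_lt_le` (…KLRegimeFrameShellCount, p465249: `FrameOK R U N μ K ⟹ #{|e_K| < η} ≤ 1793ηL² + 704L`, `0 < η ≤ 3/80`) at `η = 5Λₙ/4 ≤ 5/512`
(`n ≥ 1`), and `704L ≤ 704L²Λₙ` once `1 ≤ L·Λₙ` — automatic at the engine's volumes (`klEngL₃ β U ≥ 1024β²`, `Λₙ ≥ π/β` for `n ≤ n_β`):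
* `one_le_mul_klScale_of_klEngL₃_le` (`1 ≤ L·Λₙ`), **`card_bandShell_le`** (`≤ 2946·L²·Λₙ`, `FrameOK` + `n ≥ 1` + `1 ≤ LΛₙ`);
* **`hshift_of_sizes_geom`** — `hshift_of_sizes_klRegime` with the geometry row DISCHARGED (`C_b := 2946`; the frame `Kₙ₋₁` is admissible by the history,
  `frameOK_klFlowFrameU_self_of_hist`): the (c) closer's `hshift` for `1 ≤ n ≤ n_β` from history + stub binders (`μ ∈ klWindowC`, `klEngL₃ β U ≤ L`) + the two
  Z facts + FOUR sizes `(a, n₆, s₂, n₄)` + the room line `547400·((8/π)·2946·n₆ + 4·s₂·n₄) ≤ klHshiftC`.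
Composition + arithmetic; nothing about the sizes is asserted; nothing here asserts (c), any stub of 20437, K3, the margin or superconductivity.
References: BGM 2006 §2.3 (2.80) [cite: BenfattoGiulianiMastropietro2006].
-/

noncomputable section

namespace Summit.HubbardSuperconductivity.HubbardSuperconductivity.Theorems.KLRegimeSplit

set_option linter.dupNamespace false -- summit = problem name (single-conjunct summit), D-0017

open Real Finset Literature.MathematicalPhysics.QuantumLattice Literature.Probability.LatticeModels GrassmannAlgebra
open Summit.HubbardSuperconductivity.HubbardSuperconductivity.Theorems.KLProgrammeLegKernels
open Summit.HubbardSuperconductivity.HubbardSuperconductivity.Theorems.EngineV8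
open Summit.HubbardSuperconductivity.HubbardSuperconductivity.Theorems.TwoVolumeDefect
open Summit.HubbardSuperconductivity.HubbardSuperconductivity.Theorems.TwoPointAssembly

section Model

variable {L M : ℕ} [NeZero L] [NeZero M] {G : GeoConsts} {P : SplitConsts} {Q : EngConsts} {R : RenConsts} {β U μ c : ℝ} {n : ℕ}

/-! ## §1 `1 ≤ L·Λₙ` at the engine's volumes; the band-shell count of an admissible frame -/

omit [NeZero L] [NeZero M] in
/-- `1024·β² ≤ klEngL₃ β U` (the volume threshold dominates `β²`). -/
theorem sq_beta_le_klEngL₃ (β U : ℝ) : 1024 * β ^ 2 ≤ (klEngL₃ β U : ℝ) := by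
  unfold klEngL₃
  push_cast
  have hceil : β ≤ (⌈|β|⌉₊ : ℝ) := (le_abs_self β).trans (Nat.le_ceil _)
  have hceil' : -β ≤ (⌈|β|⌉₊ : ℝ) := (neg_le_abs β).trans (Nat.le_ceil _)
  have h1 : (1 : ℝ) ≤ ((⌈|U|⁻¹⌉₊ : ℝ) + 1) ^ 2 := by
    have : (0 : ℝ) ≤ (⌈|U|⁻¹⌉₊ : ℝ) := Nat.cast_nonneg _
    nlinarith
  have h2 : β ^ 2 ≤ ((⌈|β|⌉₊ : ℝ) + 1) ^ 2 := by
    have h0 : (0 : ℝ) ≤ (⌈|β|⌉₊ : ℝ) := Nat.cast_nonneg _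
    nlinarith [sq_nonneg (β - (⌈|β|⌉₊ : ℝ)), sq_abs β]
  have h3 : (0 : ℝ) ≤ ((⌈|β|⌉₊ : ℝ) + 1) ^ 2 := by positivity
  nlinarith

omit [NeZero L] [NeZero M] in
/-- **`1 ≤ L·Λₙ` for `n ≤ n_β` at the engine's volumes** (`L ≥ klEngL₃ β U ≥ 1024β²`, `Λₙ ≥ π/β`). -/
theorem one_le_mul_klScale_of_klEngL₃_le (hβmin : klBetaMin ≤ β) (hL : klEngL₃ β U ≤ L) (hn : n ≤ nScales β) :
    1 ≤ (L : ℝ) * klScale klE0 n := by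
  have hβ0 : 0 < β := pos_of_klBetaMin_le hβmin
  have h128 : (128 : ℝ) ≤ β := by simpa [klBetaMin] using hβmin
  have hΛ : Real.pi / β ≤ klScale klE0 n := (klth_pi_div_le_klScale_nScales hβmin).trans (klld_klScale_anti hn)
  have hLr : 1024 * β ^ 2 ≤ (L : ℝ) := (sq_beta_le_klEngL₃ β U).trans (by exact_mod_cast hL)
  have hπ3 : (3 : ℝ) < Real.pi := Real.pi_gt_three
  have h1 : 1024 * β ^ 2 * (Real.pi / β) ≤ (L : ℝ) * klScale klE0 n :=
    mul_le_mul hLr hΛ (by positivity) (Nat.cast_nonneg L)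
  have h2 : 1024 * β ^ 2 * (Real.pi / β) = 1024 * β * Real.pi := by field_simp
  rw [h2] at h1
  nlinarith

omit [NeZero M] in
/-- **The band-shell count of an admissible frame at scale `n ≥ 1`**: `FrameOK R U N μ K`, `1 ≤ L·Λₙ` ⟹ `#{k⃗ : |e_K(k⃗)| < 5Λₙ/4} ≤ 2946·L²·Λₙ`
(`card_frameLevel_lt_le` at `η = 5Λₙ/4 ≤ 5/512 < 3/80`; `704L ≤ 704L²Λₙ`). [cite: BenfattoGiulianiMastropietro2006, §2.3 (2.80)] -/
theorem card_bandShell_le {N : ℕ} {K : TrigPolyC4v} (hK : FrameOK R U N μ K) (hn1 : 1 ≤ n) (hLΛ : 1 ≤ (L : ℝ) * klScale klE0 n) :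
    (((Finset.univ.filter fun kv : TorusSite 2 L => |nambuXiCT L μ K kv| < 5 * klScale klE0 n / 4).card : ℕ) : ℝ) ≤
      2946 * (L : ℝ) ^ 2 * klScale klE0 n := by
  have hΛ : 0 < klScale klE0 n := klth_klScale_pos n
  obtain ⟨m, rfl⟩ : ∃ m, n = m + 1 := ⟨n - 1, by omega⟩
  have hΛle : klScale klE0 (m + 1) ≤ 1 / 128 := by
    rw [klScale_succ_eq_inv]
    have h4 : (4 : ℝ) ≤ 4 ^ (m + 1) := by
      calc (4 : ℝ) = 4 ^ 1 := (pow_one _).symm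
        _ ≤ 4 ^ (m + 1) := pow_le_pow_right₀ (by norm_num) (by omega)
    rw [inv_eq_one_div, div_le_div_iff₀ (by positivity) (by norm_num)]
    linarith
  have hη : 0 < 5 * klScale klE0 (m + 1) / 4 := by positivity
  have hηr : 5 * klScale klE0 (m + 1) / 4 ≤ 3 / 80 := by linarith
  have h := card_frameLevel_lt_le (L := L) hK hη hηr
  have hL : (0 : ℝ) ≤ L := Nat.cast_nonneg L
  have hL1 : (L : ℝ) ≤ (L : ℝ) ^ 2 * klScale klE0 (m + 1) := by nlinarith
  nlinarith

/-! ## §2 `hshift_of_sizes` with the geometry row discharged -/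

/-- **THE (c) CLOSER'S `hshift` FOR `1 ≤ n ≤ n_β`, GEOMETRY DISCHARGED**: `hshift_of_sizes_klRegime` with the band-shell count supplied by `card_bandShell_le`
(`C_b = 2946`; the frame `Kₙ₋₁` is admissible by the history) — inputs: history, stub binders (`μ ∈ klWindowC`, `klEngL₃ β U ≤ L`), the two partition-function
facts of the mismatch path, FOUR sizes `a, n₆, s₂, n₄` and the room line. [cite: BenfattoGiulianiMastropietro2006, §2.3 (2.21)–(2.24), §3 (3.3)] -/
theorem hshift_of_sizes_geom (hμ : μ ∈ klWindowC) (hL : klEngL₃ β U ≤ L)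
    (hβmin : klBetaMin ≤ β)
    (hnβ : n ≤ nScales β)
    (hhist : HistP klPredsV17F2 L M G P Q R β U μ 0 n)
    (hn1 : 1 ≤ n)
    (hP : P.WF)
    (hRW : R.WF)
    (hQ : (klEngQ8 P R).IsRaiseOf Q)
    (hU : 0 < U)
    (hU4 : U ≤ klEngU₀4 P R c)
    (hβ : 0 < β)
    {Qm x y : TorusSite 2 L}
    (hZ₂ : effPartitionFn ℂ (normalCovariance L M (uvSymbolCT L M β μ (klFlowFrameU L M β U μ n) (klScale klE0 n)))
      (hubbardInteraction L M β U + counterQuadratic L M β (klFlowFrameU L M β U μ n)) ≠ 0)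
    {s₀ s₁ : FreqMomentum L M × Fin 2 → ℂ}
    (hs₀ : s₀ = uvSymbolCT L M β μ (klFlowFrameU L M β U μ (n - 1)) (klScale klE0 n))
    (hs₁ : s₁ = fun ks => uvSymbolCT L M β μ (klFlowFrameU L M β U μ n) (klScale klE0 n) ks /
      (1 + uvSymbolCT L M β μ (klFlowFrameU L M β U μ n) (klScale klE0 n) ks *
        (((fsub (klFlowFrameU L M β U μ n) (klFlowFrameU L M β U μ (n - 1))).eval (latticeMomentum L ks.1.2) / (β * (L : ℝ) ^ 2) : ℝ) : ℂ)))
    (hZ : ∀ t ∈ Set.Icc (0 : ℝ) 1, effPartitionFn ℂ (normalCovariance L M s₀ + ((t : ℂ)) • (normalCovariance L M s₁ - normalCovariance L M s₀))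
      (hubbardInteraction L M β U + counterQuadratic L M β (klFlowFrameU L M β U μ (n - 1))) ≠ 0)
    {a n₆ s₂ n₄ : ℝ}
    (ha0 : 0 ≤ a)
    (ha : a ≤ 2 ^ 28)
    (hn₆ : 0 ≤ n₆)
    (hs₂ : 0 ≤ s₂)
    (hn₄ : 0 ≤ n₄)
    (hroom : 547400 * (8 / Real.pi * 2946 * n₆ + 4 * s₂ * n₄) ≤ klHshiftC)
    (hC4 : ‖klPairAmplitude L M β U μ (klFlowFrameU L M β U μ n) n Qm x y‖ ≤ a * (P.Klam * |U|))
    (hN6 : ∀ t ∈ Set.Icc (0 : ℝ) 1, ∀ A : HubbardFieldIdx L M,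
      ‖kernel ℂ (effAction ℂ (normalCovariance L M s₀ + ((t : ℂ)) • (normalCovariance L M s₁ - normalCovariance L M s₀))
        (hubbardInteraction L M β U + counterQuadratic L M β (klFlowFrameU L M β U μ (n - 1)))) 6
        (Fin.snoc (Fin.snoc ![(((omega0 M, y), 0), 0), ((((omega0 M).rev, Qm - y), 1), 0), ((((omega0 M).rev, Qm - x), 1), 1), (((omega0 M, x), 0), 1)] (A.1, 1 - A.2) : Fin 5 → HubbardFieldIdx L M) A)‖ ≤
          n₆ * (P.Klam * U) ^ 2 / klScale klE0 n / (720 * (β * (L : ℝ) ^ 2) ^ 5))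
    (hS : ∀ t ∈ Set.Icc (0 : ℝ) 1, ∀ i : Fin 4,
      |nambuXiCT L μ (klFlowFrameU L M β U μ (n - 1)) ((![(((omega0 M, y), 0), 0), ((((omega0 M).rev, Qm - y), 1), 0), ((((omega0 M).rev, Qm - x), 1), 1), (((omega0 M, x), 0), 1)] :
              Fin 4 → HubbardFieldIdx L M) i).1.1.2| < 5 * klScale klE0 n / 4 →
      ‖kernel ℂ (effAction ℂ (normalCovariance L M s₀ + ((t : ℂ)) • (normalCovariance L M s₁ - normalCovariance L M s₀))
        (hubbardInteraction L M β U + counterQuadratic L M β (klFlowFrameU L M β U μ (n - 1)))) 2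
        ![((((![(((omega0 M, y), 0), 0), ((((omega0 M).rev, Qm - y), 1), 0), ((((omega0 M).rev, Qm - x), 1), 1), (((omega0 M, x), 0), 1)] :
              Fin 4 → HubbardFieldIdx L M) i).1,
            1 - ((![(((omega0 M, y), 0), 0), ((((omega0 M).rev, Qm - y), 1), 0), ((((omega0 M).rev, Qm - x), 1), 1), (((omega0 M, x), 0), 1)] :
              Fin 4 → HubbardFieldIdx L M) i).2) : HubbardFieldIdx L M),
          (![(((omega0 M, y), 0), 0), ((((omega0 M).rev, Qm - y), 1), 0), ((((omega0 M).rev, Qm - x), 1), 1), (((omega0 M, x), 0), 1)] :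
              Fin 4 → HubbardFieldIdx L M) i]‖ ≤ s₂ * |U| * klScale klE0 n / (2 * (β * (L : ℝ) ^ 2)))
    (hN4 : ∀ t ∈ Set.Icc (0 : ℝ) 1,
      ‖kernel ℂ (effAction ℂ (normalCovariance L M s₀ + ((t : ℂ)) • (normalCovariance L M s₁ - normalCovariance L M s₀))
        (hubbardInteraction L M β U + counterQuadratic L M β (klFlowFrameU L M β U μ (n - 1)))) 4
        ![(((omega0 M, y), 0), 0), ((((omega0 M).rev, Qm - y), 1), 0), ((((omega0 M).rev, Qm - x), 1), 1), (((omega0 M, x), 0), 1)]‖ ≤ n₄ * (P.Klam * |U|) / (24 * (β * (L : ℝ) ^ 2) ^ 3)) :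
    ‖klPairAmplitude L M β U μ (klFlowFrameU L M β U μ n) n Qm x y - klPairAmplitude L M β U μ (klFlowFrameU L M β U μ (n - 1)) n Qm x y‖ ≤
      frameShiftBar P Q U n := by
  have hK₁ : FrameOK R U (n - 1) μ (klFlowFrameU L M β U μ (n - 1)) := frameOK_klFlowFrameU_self_of_hist hhist hRW hμ (n - 1) (Nat.sub_le n 1)
  have hLΛ := one_le_mul_klScale_of_klEngL₃_le (L := L) hβmin hL hnβ
  have hband := card_bandShell_le (L := L) (μ := μ) hK₁ hn1 hLΛ
  exact hshift_of_sizes_klRegime (Cb := 2946) hβmin hnβ hhist hn1 hP hRW hQ hU hU4 hβ hZ₂ hs₀ hs₁ hZ ha0 ha hn₆ hs₂ hn₄ hroom hC4 hN6 hS hN4 hband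

end Model

end Summit.HubbardSuperconductivity.HubbardSuperconductivity.Theorems.KLRegimeSplit

end
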